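import Summits.QuantumFields.BalabanUV.T4Continuum.Support.NE7CoarseAxialPoincare
import Summits.QuantumFields.BalabanUV.T4Continuum.Support.NE7TangentCriticalCover
import Summits.QuantumFields.BalabanUV.T4Continuum.Support.NE3SmoothRightInverseBounds
import Summits.QuantumFields.BalabanUV.T4Continuum.Support.NE7CentredRepresentative
import HarnessLib

/-!
# NE7CoarseSplitExtension — THE NEAR DATUM OF THE v4 SPLIT: a coarse 1-form `ψ` with plaquette circulations `≤ ĝ₀` and size `≤ Ψ` on a cube of radius `2ℓ̃+2`
# around a centre `c` (period `N ≥ 4ℓ̃ + 8`) has an `N`-PERIODIC extension `φ₁` of its restriction to the `ℓ̃−1` torus-ball — `φ₁ = ψ` there — with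
# `sup‖curl_1 φ₁‖ ≤ (1 + 12(d+1))·ĝ₀` EVERYWHERE and `sup‖φ₁‖ ≤ (d+1)(4ℓ̃+2)(2Ψ + ĝ₀)`: cut off the AXIAL REMAINDER `a = ψ − dλ` (F270: `‖a‖ ≤ |·|₁ĝ₀`), keep the
# gradient part as a gradient, `φ₁ = dPot(χ̃λ) + χ̃a` read on the centred representative

Cell `pub-balaban`, rung (B)+1 sub-cell t4, lineage `b2b-balaban-t4-ne7-p1` (CRUX PROVER NE7 #1 = OWNER of row NE7), generation 89; memo
`t4/b2b-balaban-t4-ne7-p1-g89/COSTING-N1.md` §8 (β).  File F271b (over F271a `NE7CentredRepresentative`, F270 `NE7CoarseAxialPoincare.norm_sub_dPot_treePot_le`, lit-balaban's `B4TorusKernel.MultiPeriod`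
(`translate ∕ centreVec ∕ torusSupNorm ∕ circAbs`: the centred representative), `B4ContourShift.supNorm`, `B7Prop1Explicit` (`asum`, `treeWord`), `SmoothRefineBlocks.mem_steps_treeWord`,
`NE3SmoothRightInverseBounds.norm_asum_le_of_steps`, `NE3SmoothRightInverseCurl.curlAt_flat_dPot`, `NE3SmoothLiftCurl.curlAt_flat_eq`, `NE7TangentCriticalCover.dir_invariant_smul_of_isPeriodicDir`).

WHY (memo §8 (β)).  The v4 END (F263 `hape_of_torusRoadV4`) wants `D_1(χA_loc) = φ₁ + E` with `φ₁` `N`-periodic, `sup‖curl_1 φ₁‖ ≤ ĝ` GLOBALLY, `E = 0` on the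
`ℓ`-ball of the plaquette's block and `‖E‖ ≤ s`.  With `ψ := D_1(χA_loc)` (whose circulations near the block are the datum's coarse curvature `β′` + quadratic, F259)
THIS FILE produces `φ₁`; `E := ψ − φ₁` then has the support and the size the END asks (`s ≤ sup‖ψ‖ + sup‖φ₁‖`).
WHAT ([folklore]; 0 def — the extension is an explicit term; 0 sorry; dimension `d + 1`).
**`exists_periodic_extension`** (statement below; the centred-representative ∕ `supNorm` ∕ clamp bookkeeping is F271a `NE7CentredRepresentative`).
HONEST FRAMING (page 1): flat lattice kinematics; nothing of Bałaban's asserted; NOT (APE), NOT ONE-STEP, NOT NE7; spine 0∕9; finite T⁴ rung (B)+1 — NOT infinite volume,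
NOT mass gap, NOT `BetaPertH`, NOT Clay.  Continuum YM on T⁴ ⇐ BetaPertH ∧ nine spine estimates (0/9 proved); BetaPertH ⇐ (D1) ∧ (D4) ∧ CAP+tail; G-an2-4 gates asym,
D1 and NE2/3/4.
-/

set_option autoImplicit false

open scoped BigOperators Matrix.Norms.L2Operator
open NormedSpace Finset

namespace Summit.QuantumFields.BalabanUV.T4Continuum.NE7CoarseSplitExtension

open Literature.MathematicalPhysics.QuantumFieldTheory.Balaban1983to89
open B7Prop1Explicit B7Prop2Explicit
open B4ContourShift (supNorm abs_le_supNorm supNorm_nonneg)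
open B4TorusKernel.MultiPeriod (translate translate_apply centreVec centre circAbs torusSupNorm abs_add_mul_centre circAbs_of_centred
  translate_centreVec_centred supNorm_translate_centreVec)
open T4AveragingDeficitWall (curlAt)
open AveragingDeficitPeriodicCounting (IsPeriodicDir)
open BlockAveragePushDirSplit (flat)
open NE3TangentNoGoWords (dPot)
open NE3SmoothLiftCurl (curlAt_flat_eq)
open NE3SmoothRightInverseCurl (curlAt_flat_dPot curlAt_flat_add)
open NE3SmoothRightInverseBounds (norm_asum_le_of_steps)
open SmoothRefineBlocks (steps mem_steps_treeWord)
open NE7TangentCriticalCover (dir_invariant_smul_of_isPeriodicDir)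
open NE7CoarseAxialPoincare (norm_sub_dPot_treePot_le)

open NE7CentredRepresentative
open Summit.QuantumFields.BalabanUV.Beta.GAN24.DirichletExhaustionDeperiodise (translate_const_eq_add_zsmul)
open Literature.NumberTheory.LFunctions.PlateauMollifier (abs_clamp_sub_clamp_le)

noncomputable section

variable {d : ℕ} {n : Type*} [Fintype n] [DecidableEq n]

/-- **THE PERIODIC EXTENSION OF THE NEAR DATUM** (`ℓ̃ ≥ 1`, `N ≥ 4ℓ̃ + 8`): for an `N`-periodic coarse 1-form `ψ` whose flat plaquette circulations based within
sup-distance `2ℓ̃+2` of `c` are `≤ ĝ₀` and whose bonds there are `≤ Ψ`, there is an `N`-periodic `φ₁` with `φ₁ = ψ` on `{torusSupNorm(· − c) ≤ ℓ̃ − 1}`,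
`‖curl_1 φ₁‖ ≤ (1 + 12(d+1))ĝ₀` EVERYWHERE and `‖φ₁‖ ≤ (d+1)(4ℓ̃+2)(2Ψ + ĝ₀)`. [folklore] -/
theorem exists_periodic_extension {N ℓt : ℕ} (hℓ : 1 ≤ ℓt) (hN : 4 * ℓt + 8 ≤ N) (c : Site (d + 1))
    (ψ : Site (d + 1) → Fin (d + 1) → Matrix n n ℂ) (hψP : IsPeriodicDir ψ (N : ℤ))
    {ĝ₀ Ψ : ℝ} (hĝ₀ : 0 ≤ ĝ₀) (hΨ0 : 0 ≤ Ψ)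
    (hcurl : ∀ y : Site (d + 1), supNorm (y - c) ≤ 2 * ℓt + 2 → ∀ μ ν : Fin (d + 1), ‖curlAt (flat (d := d + 1) (n := n)) ψ y μ ν‖ ≤ ĝ₀)
    (hsize : ∀ y : Site (d + 1), supNorm (y - c) ≤ 2 * ℓt + 2 → ∀ κ : Fin (d + 1), ‖ψ y κ‖ ≤ Ψ) :
    ∃ φ₁ : Site (d + 1) → Fin (d + 1) → Matrix n n ℂ,
      IsPeriodicDir φ₁ (N : ℤ) ∧
      (∀ (y : Site (d + 1)) (κ : Fin (d + 1)), torusSupNorm (fun _ : Fin (d + 1) => N) (y - c) ≤ (ℓt : ℝ) - 1 → φ₁ y κ = ψ y κ) ∧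
      (∀ (y : Site (d + 1)) (μ ν : Fin (d + 1)), ‖curlAt (flat (d := d + 1) (n := n)) φ₁ y μ ν‖ ≤ (1 + 12 * ((d : ℝ) + 1)) * ĝ₀) ∧
      (∀ (y : Site (d + 1)) (κ : Fin (d + 1)), ‖φ₁ y κ‖ ≤ ((d : ℝ) + 1) * (4 * ℓt + 2) * (2 * Ψ + ĝ₀)) := by
  classical
  have hN1 : 1 ≤ N := by omega
  have hℓr : (1 : ℝ) ≤ ℓt := by exact_mod_cast hℓ
  have hℓpos : (0 : ℝ) < ℓt := by linarith
  -- the hypotheses at integer radii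
  have hcurl' : ∀ y : Site (d + 1), supNorm (y - c) ≤ ((2 * ℓt + 2 : ℕ) : ℝ) → ∀ μ ν : Fin (d + 1),
      ‖curlAt (flat (d := d + 1) (n := n)) ψ y μ ν‖ ≤ ĝ₀ := fun y hy => hcurl y (by push_cast at hy; exact hy)
  have hsize' : ∀ y : Site (d + 1), supNorm (y - c) ≤ ((2 * ℓt + 2 : ℕ) : ℝ) → ∀ κ : Fin (d + 1), ‖ψ y κ‖ ≤ Ψ :=
    fun y hy => hsize y (by push_cast at hy; exact hy)
  -- the objects
  obtain ⟨q, hq⟩ : ∃ q : Site (d + 1), q = fun i => c i - ((2 * ℓt + 1 : ℕ) : ℤ) := ⟨_, rfl⟩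
  obtain ⟨lam, hlam⟩ : ∃ lam : Site (d + 1) → Matrix n n ℂ, lam = fun y => asum ψ q (treeWord (y - q)) := ⟨_, rfl⟩
  obtain ⟨a, ha⟩ : ∃ a : Site (d + 1) → Fin (d + 1) → Matrix n n ℂ, a = fun y κ => ψ y κ - dPot lam y κ := ⟨_, rfl⟩
  obtain ⟨χ, hχ⟩ : ∃ χ : Site (d + 1) → ℝ, χ = fun y => max 0 (min 1 (((2 * ℓt : ℝ) - supNorm (y - c)) / ℓt)) := ⟨_, rfl⟩
  obtain ⟨f, hf⟩ : ∃ f : Site (d + 1) → Fin (d + 1) → Matrix n n ℂ,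
      f = fun y κ => dPot (fun x => χ x • lam x) y κ + χ y • a y κ := ⟨_, rfl⟩
  obtain ⟨wr, hwr⟩ : ∃ wr : Site (d + 1) → Site (d + 1),
      wr = fun v => translate (fun _ : Fin (d + 1) => N) v (centreVec (fun _ : Fin (d + 1) => N) v) := ⟨_, rfl⟩
  -- χ facts
  have hχ01 : ∀ y, 0 ≤ χ y ∧ χ y ≤ 1 := fun y => by rw [hχ]; exact clamp_mem _
  have hχ1 : ∀ y, supNorm (y - c) ≤ ℓt → χ y = 1 := by
    intro y hy
    rw [hχ]
    have h1 : (1 : ℝ) ≤ ((2 * ℓt : ℝ) - supNorm (y - c)) / ℓt := by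
      rw [le_div_iff₀ hℓpos]; linarith
    simp only [min_eq_left h1]
    simp
  have hχ0 : ∀ y, (2 * ℓt : ℝ) ≤ supNorm (y - c) → χ y = 0 := by
    intro y hy
    rw [hχ]
    have h1 : ((2 * ℓt : ℝ) - supNorm (y - c)) / ℓt ≤ 0 := div_nonpos_of_nonpos_of_nonneg (by linarith) hℓpos.le
    have h2 : min 1 (((2 * ℓt : ℝ) - supNorm (y - c)) / ℓt) ≤ 0 := (min_le_right _ _).trans h1
    simp only [max_eq_left h2]
  have hχne : ∀ y, χ y ≠ 0 → supNorm (y - c) < 2 * ℓt := fun y h => by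
    by_contra hh; push Not at hh; exact h (hχ0 y hh)
  have hχlip : ∀ (y : Site (d + 1)) (μ : Fin (d + 1)), |χ (y + e μ) - χ y| ≤ 1 / ℓt := by
    intro y μ
    rw [hχ]
    refine (abs_clamp_sub_clamp_le _ _).trans ?_
    have e1 : y + e μ - c = (y - c) + e μ := by abel
    rw [e1, ← sub_div, abs_div, abs_of_pos hℓpos]
    refine div_le_div_of_nonneg_right ?_ hℓpos.le
    have h1 := supNorm_add_e_le (y - c) μ
    have h2 := supNorm_le_add_e (y - c) μ
    rw [abs_le]; constructor <;> linarith
  -- (L2) the axial remainder on the cube of radius `2ℓ̃+1`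
  have hA : ∀ (y : Site (d + 1)), supNorm (y - c) ≤ ((2 * ℓt + 1 : ℕ) : ℝ) → ∀ κ, ‖a y κ‖ ≤ ((d : ℝ) + 1) * (4 * ℓt + 2) * ĝ₀ := by
    intro y hy κ
    have hyc : ∀ i, c i - (2 * (ℓt : ℤ) + 1) ≤ y i ∧ y i ≤ c i + (2 * (ℓt : ℤ) + 1) := fun i => by
      have := box_of_supNorm_le hy i; push_cast at this; exact this
    have hqi : ∀ i, q i = c i - (2 * (ℓt : ℤ) + 1) := fun i => by rw [hq]; push_cast; ring
    have hw0 : ∀ i, 0 ≤ y i - q i := fun i => by rw [hqi]; linarith [(hyc i).1]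
    set w : Fin (d + 1) → ℕ := fun i => (y i - q i).toNat with hwdef
    have hwi : ∀ i, ((w i : ℕ) : ℤ) = y i - q i := fun i => Int.toNat_of_nonneg (hw0 i)
    have hyw : y = q + fun i => ((w i : ℕ) : ℤ) := by funext i; rw [Pi.add_apply, hwi]; ring
    have hwleZ : ∀ i, ((w i : ℕ) : ℤ) ≤ 4 * ℓt + 2 := fun i => by
      rw [hwi, hqi]; linarith [(hyc i).2]
    have hG : ∀ y' : Site (d + 1), (∀ i, q i ≤ y' i ∧ y' i ≤ q i + w i) → ∀ m : Fin (d + 1), ‖asum ψ y' (plaqWord m κ)‖ ≤ ĝ₀ := by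
      intro y' hy' m
      have hy'c : supNorm (y' - c) ≤ ((2 * ℓt + 2 : ℕ) : ℝ) := by
        refine supNorm_le_of_box fun i => ?_
        have h1 := (hy' i).1; have h2 := (hy' i).2
        rw [hwi] at h2
        rw [hqi] at h1 h2
        push_cast
        constructor <;> linarith [(hyc i).2]
      rw [asum_plaqWord]
      have hc := hcurl' y' hy'c m κ
      rw [curlAt_flat_eq] at hc
      rw [show ψ y' m + ψ (y' + e m) κ - ψ (y' + e κ) m - ψ y' κ = (ψ (y' + e m) κ - ψ y' κ) - (ψ (y' + e κ) m - ψ y' m) by abel]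
      exact hc
    have hP := norm_sub_dPot_treePot_le ψ q w κ hĝ₀ hG
    rw [← hyw, ← hlam] at hP
    have hsum : (∑ i, (w i : ℝ)) ≤ ((d : ℝ) + 1) * (4 * ℓt + 2) := by
      calc (∑ i, (w i : ℝ)) ≤ ∑ _i : Fin (d + 1), (4 * (ℓt : ℝ) + 2) :=
            Finset.sum_le_sum fun i _ => by have := hwleZ i; exact_mod_cast this
        _ = ((d : ℝ) + 1) * (4 * ℓt + 2) := by simp [Finset.sum_const, Finset.card_univ, Fintype.card_fin]; ring
    rw [ha]
    exact hP.trans (mul_le_mul_of_nonneg_right hsum hĝ₀)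
  -- (L3) the tree potential on the cube of radius `2ℓ̃+1`
  have hΛ : ∀ (y : Site (d + 1)), supNorm (y - c) ≤ ((2 * ℓt + 1 : ℕ) : ℝ) → ‖lam y‖ ≤ ((d : ℝ) + 1) * (4 * ℓt + 2) * Ψ := by
    intro y hy
    have hyc : ∀ i, c i - (2 * (ℓt : ℤ) + 1) ≤ y i ∧ y i ≤ c i + (2 * (ℓt : ℤ) + 1) := fun i => by
      have := box_of_supNorm_le hy i; push_cast at this; exact this
    have hqi : ∀ i, q i = c i - (2 * (ℓt : ℤ) + 1) := fun i => by rw [hq]; push_cast; ring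
    have hv0 : ∀ i, 0 ≤ (y - q) i := fun i => by rw [Pi.sub_apply, hqi]; linarith [(hyc i).1]
    have hsteps : ∀ s ∈ steps q (treeWord (y - q)), ‖stepA ψ s.1 s.2‖ ≤ Ψ := by
      intro s hs
      obtain ⟨y', κ, rfl, hqy', hy'y⟩ := mem_steps_treeWord q (y - q) hv0 s hs
      rw [stepA_true]
      refine hsize' y' (supNorm_le_of_box fun i => ?_) κ
      have h1 : q i ≤ y' i := hqy' i
      have h2 : (y' + e κ) i ≤ (q + (y - q)) i := hy'y i
      rw [Pi.add_apply, Pi.add_apply, Pi.sub_apply] at h2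
      have he : (0 : ℤ) ≤ e κ i := by rw [e_apply]; split_ifs <;> norm_num
      rw [hqi] at h1 h2
      push_cast
      constructor <;> linarith [(hyc i).2]
    have h := norm_asum_le_of_steps ψ (treeWord (y - q)) q hsteps
    rw [length_treeWord] at h
    rw [hlam]
    refine h.trans (mul_le_mul_of_nonneg_right ?_ hΨ0)
    -- `|y − q|₁ ≤ (d+1)(4ℓ̃+2)`
    have hl1 : ((l1 (y - q) : ℕ) : ℝ) = ∑ i, (((y - q) i).natAbs : ℝ) := by unfold l1; push_cast; rfl
    rw [hl1]
    calc ∑ i, (((y - q) i).natAbs : ℝ) ≤ ∑ _i : Fin (d + 1), (4 * (ℓt : ℝ) + 2) := by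
          refine Finset.sum_le_sum fun i _ => ?_
          have h1 : ((((y - q) i).natAbs : ℕ) : ℤ) = (y - q) i := Int.natAbs_of_nonneg (hv0 i)
          have h3 : (y - q) i ≤ 4 * ℓt + 2 := by
            rw [Pi.sub_apply, hqi]; linarith [(hyc i).2]
          have h4 : ((((y - q) i).natAbs : ℕ) : ℤ) ≤ 4 * ℓt + 2 := by rw [h1]; exact h3
          exact_mod_cast h4
      _ = ((d : ℝ) + 1) * (4 * ℓt + 2) := by simp [Finset.sum_const, Finset.card_univ, Fintype.card_fin]; ring
  -- (L4) support of `f`; (L5) `f = ψ` near the centre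
  have hf0 : ∀ (y : Site (d + 1)) (κ : Fin (d + 1)), (2 * ℓt : ℝ) + 1 ≤ supNorm (y - c) → f y κ = 0 := by
    intro y κ hy
    have h1 : χ y = 0 := hχ0 y (by linarith)
    have h2 : χ (y + e κ) = 0 :=
      hχ0 _ (by have := supNorm_le_add_e (y - c) κ; rw [show y + e κ - c = y - c + e κ by abel]; linarith)
    rw [hf]
    simp only [dPot, h1, h2, zero_smul, sub_self, add_zero]
  have hfψ : ∀ (y : Site (d + 1)) (κ : Fin (d + 1)), supNorm (y - c) ≤ (ℓt : ℝ) - 1 → f y κ = ψ y κ := by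
    intro y κ hy
    have h1 : χ y = 1 := hχ1 y (by linarith)
    have h2 : χ (y + e κ) = 1 :=
      hχ1 _ (by have := supNorm_add_e_le (y - c) κ; rw [show y + e κ - c = y - c + e κ by abel]; linarith)
    rw [hf]
    simp only [dPot, h1, h2, one_smul, ha]
    abel
  -- (L6) the curl of `f`
  have hcurlf : ∀ (y : Site (d + 1)) (μ ν : Fin (d + 1)), ‖curlAt (flat (d := d + 1) (n := n)) f y μ ν‖ ≤ (1 + 12 * ((d : ℝ) + 1)) * ĝ₀ := by
    intro y μ ν
    have hsplit : f = dPot (fun x => χ x • lam x) + fun y κ => χ y • a y κ := by rw [hf]; rfl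
    rw [hsplit, curlAt_flat_add, curlAt_flat_dPot, zero_add, curlAt_flat_weight]
    -- `curl_1 a = curl_1 ψ`
    have hca : curlAt (flat (d := d + 1) (n := n)) a y μ ν = curlAt (flat (d := d + 1) (n := n)) ψ y μ ν := by
      have e1 : a = ψ + dPot (fun x => -lam x) := by
        rw [ha]; funext y κ; simp only [Pi.add_apply, dPot]; abel
      rw [e1, curlAt_flat_add, curlAt_flat_dPot, add_zero]
    rw [hca]
    -- the three terms
    have t1 : ‖χ y • curlAt (flat (d := d + 1) (n := n)) ψ y μ ν‖ ≤ ĝ₀ := by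
      by_cases h : χ y = 0
      · rw [h, zero_smul, norm_zero]; exact hĝ₀
      · rw [norm_smul, Real.norm_eq_abs, abs_of_nonneg (hχ01 y).1]
        have hyc : supNorm (y - c) ≤ ((2 * ℓt + 2 : ℕ) : ℝ) := by push_cast; linarith [hχne y h]
        have := hcurl' y hyc μ ν
        calc χ y * ‖curlAt (flat (d := d + 1) (n := n)) ψ y μ ν‖ ≤ 1 * ĝ₀ := mul_le_mul (hχ01 y).2 this (norm_nonneg _) zero_le_one
          _ = ĝ₀ := one_mul _
    have tside : ∀ τ σ : Fin (d + 1), ‖(χ (y + e τ) - χ y) • a (y + e τ) σ‖ ≤ 1 / ℓt * (((d : ℝ) + 1) * (4 * ℓt + 2) * ĝ₀) := by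
      intro τ σ
      by_cases h : χ (y + e τ) = 0 ∧ χ y = 0
      · rw [h.1, h.2, sub_self, zero_smul, norm_zero]; positivity
      · have hnear : supNorm (y + e τ - c) ≤ ((2 * ℓt + 1 : ℕ) : ℝ) := by
          push_cast
          rcases not_and_or.mp h with h1 | h1
          · have := hχne _ h1; linarith
          · have h3 := supNorm_add_e_le (y - c) τ
            have h4 := hχne _ h1
            rw [show y + e τ - c = y - c + e τ by abel]
            have h5 := supNorm_int_gap (y - c + e τ) (k := 2 * ℓt + 1)
            by_contra hh
            push Not at hh
            push_cast at h5
            have h6 := h5 hh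
            linarith
        rw [norm_smul, Real.norm_eq_abs]
        exact mul_le_mul (hχlip y τ) (hA _ hnear σ) (norm_nonneg _) (by positivity)
    have h12 : 1 / (ℓt : ℝ) * (((d : ℝ) + 1) * (4 * ℓt + 2) * ĝ₀) ≤ 6 * ((d : ℝ) + 1) * ĝ₀ := by
      rw [div_mul_eq_mul_div, one_mul, div_le_iff₀ hℓpos]
      have : ((d : ℝ) + 1) * (4 * ℓt + 2) * ĝ₀ ≤ ((d : ℝ) + 1) * (6 * ℓt) * ĝ₀ := by
        apply mul_le_mul_of_nonneg_right _ hĝ₀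
        apply mul_le_mul_of_nonneg_left _ (by positivity)
        linarith
      linarith
    calc ‖χ y • curlAt (flat (d := d + 1) (n := n)) ψ y μ ν + (χ (y + e μ) - χ y) • a (y + e μ) ν - (χ (y + e ν) - χ y) • a (y + e ν) μ‖
        ≤ ‖χ y • curlAt (flat (d := d + 1) (n := n)) ψ y μ ν‖ + ‖(χ (y + e μ) - χ y) • a (y + e μ) ν‖ + ‖(χ (y + e ν) - χ y) • a (y + e ν) μ‖ :=
          (norm_sub_le _ _).trans (add_le_add (norm_add_le _ _) le_rfl)
      _ ≤ ĝ₀ + 6 * ((d : ℝ) + 1) * ĝ₀ + 6 * ((d : ℝ) + 1) * ĝ₀ := add_le_add (add_le_add t1 ((tside μ ν).trans h12)) ((tside ν μ).trans h12)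
      _ = (1 + 12 * ((d : ℝ) + 1)) * ĝ₀ := by ring
  -- (L7) the size of `f`
  have hsizef : ∀ (y : Site (d + 1)) (κ : Fin (d + 1)), ‖f y κ‖ ≤ ((d : ℝ) + 1) * (4 * ℓt + 2) * (2 * Ψ + ĝ₀) := by
    intro y κ
    have hB0 : 0 ≤ ((d : ℝ) + 1) * (4 * ℓt + 2) * (2 * Ψ + ĝ₀) := by positivity
    by_cases h : χ (y + e κ) = 0 ∧ χ y = 0
    · rw [hf]; simp only [dPot, h.1, h.2, zero_smul, sub_self, add_zero, norm_zero]; exact hB0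
    · have hy : supNorm (y - c) ≤ 2 * ℓt := by
        rcases not_and_or.mp h with h1 | h1
        · have h3 := supNorm_le_add_e (y - c) κ
          rw [show y - c + e κ = y + e κ - c by abel] at h3
          have h4 := hχne _ h1
          by_contra hh
          push Not at hh
          have h5 := supNorm_int_gap (y - c) (k := 2 * ℓt) (by push_cast; exact hh)
          push_cast at h5
          linarith
        · linarith [hχne _ h1]
      have hy1 : supNorm (y - c) ≤ ((2 * ℓt + 1 : ℕ) : ℝ) := by push_cast; linarith
      have hyκ : supNorm (y + e κ - c) ≤ ((2 * ℓt + 1 : ℕ) : ℝ) := by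
        have := supNorm_add_e_le (y - c) κ; rw [show y + e κ - c = y - c + e κ by abel]; push_cast; linarith
      have n1 : ‖χ (y + e κ) • lam (y + e κ)‖ ≤ ((d : ℝ) + 1) * (4 * ℓt + 2) * Ψ := by
        rw [norm_smul, Real.norm_eq_abs, abs_of_nonneg (hχ01 _).1]
        calc χ (y + e κ) * ‖lam (y + e κ)‖ ≤ 1 * (((d : ℝ) + 1) * (4 * ℓt + 2) * Ψ) :=
              mul_le_mul (hχ01 _).2 (hΛ _ hyκ) (norm_nonneg _) zero_le_one
          _ = _ := one_mul _
      have n2 : ‖χ y • lam y‖ ≤ ((d : ℝ) + 1) * (4 * ℓt + 2) * Ψ := by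
        rw [norm_smul, Real.norm_eq_abs, abs_of_nonneg (hχ01 _).1]
        calc χ y * ‖lam y‖ ≤ 1 * (((d : ℝ) + 1) * (4 * ℓt + 2) * Ψ) :=
              mul_le_mul (hχ01 _).2 (hΛ _ hy1) (norm_nonneg _) zero_le_one
          _ = _ := one_mul _
      have n3 : ‖χ y • a y κ‖ ≤ ((d : ℝ) + 1) * (4 * ℓt + 2) * ĝ₀ := by
        rw [norm_smul, Real.norm_eq_abs, abs_of_nonneg (hχ01 _).1]
        calc χ y * ‖a y κ‖ ≤ 1 * (((d : ℝ) + 1) * (4 * ℓt + 2) * ĝ₀) :=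
              mul_le_mul (hχ01 _).2 (hA _ hy1 κ) (norm_nonneg _) zero_le_one
          _ = _ := one_mul _
      rw [hf]
      simp only [dPot]
      calc ‖χ (y + e κ) • lam (y + e κ) - χ y • lam y + χ y • a y κ‖
          ≤ ‖χ (y + e κ) • lam (y + e κ)‖ + ‖χ y • lam y‖ + ‖χ y • a y κ‖ := (norm_add_le _ _).trans (add_le_add (norm_sub_le _ _) le_rfl)
        _ ≤ _ := by nlinarith [n1, n2, n3]
  -- the centred representative: facts (always unfolded through `hwr`)
  have W4 : ∀ v : Site (d + 1), wr v = v + (N : ℤ) • centreVec (fun _ : Fin (d + 1) => N) v := fun v => by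
    rw [hwr]; exact wrap_eq_add_smul N v
  have W1 : ∀ u m : Site (d + 1), wr (u + (N : ℤ) • m) = wr u := fun u m => by
    simp only [hwr]; exact wrap_add_smul_vec hN1 u m
  have W2 : ∀ u : Site (d + 1), (∀ i, 2 * |u i| < N) → wr u = u := fun u hu => by
    simp only [hwr]; exact wrap_eq_self_of_small hN1 hu
  have W3 : ∀ v : Site (d + 1), supNorm (wr v) = torusSupNorm (fun _ : Fin (d + 1) => N) v := fun v => by
    simp only [hwr]; exact supNorm_wrap hN1 v
  have W5 : ∀ (v : Site (d + 1)) (i : Fin (d + 1)), wr (v + (N : ℤ) • e i) = wr v := fun v i => by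
    simp only [hwr]; exact wrap_add_period hN1 v i
  have hwr_small : ∀ v : Site (d + 1), supNorm (wr v) ≤ ((2 * ℓt + 1 : ℕ) : ℝ) → ∀ τ : Fin (d + 1), wr (v + e τ) = wr v + e τ := by
    intro v hv τ
    have hsmall : ∀ i, 2 * |(wr v + e τ) i| < N := by
      intro i
      have h1 := (supNorm_le_iff _ _).mp hv i
      have h4 : (|wr v i| : ℤ) ≤ ((2 * ℓt + 1 : ℕ) : ℤ) := by exact_mod_cast h1
      have h2 : |(wr v + e τ) i| ≤ |wr v i| + 1 := by
        rw [Pi.add_apply, e_apply]; split_ifs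
        · exact (abs_add_le _ _).trans (by simp)
        · simp
      have hN' : (4 * ℓt + 8 : ℤ) ≤ N := by exact_mod_cast hN
      push_cast at h4
      linarith
    have e1 : v + e τ = (wr v + e τ) + (N : ℤ) • (-centreVec (fun _ : Fin (d + 1) => N) v) := by
      rw [W4 v, smul_neg]; abel
    calc wr (v + e τ) = wr ((wr v + e τ) + (N : ℤ) • (-centreVec (fun _ : Fin (d + 1) => N) v)) := by rw [← e1]
      _ = wr (wr v + e τ) := W1 _ _
      _ = wr v + e τ := W2 _ hsmall
  have hwr_per : ∀ (v : Site (d + 1)) (τ : Fin (d + 1)), torusSupNorm (fun _ : Fin (d + 1) => N) v ≤ supNorm (wr (v + e τ)) + 1 := by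
    intro v τ
    -- `v = translate N (wr(v+e_τ) − e_τ) (−m)`
    have e1 : v = translate (fun _ : Fin (d + 1) => N) (wr (v + e τ) - e τ) (-centreVec (fun _ : Fin (d + 1) => N) (v + e τ)) := by
      rw [translate_const_eq_add_zsmul, W4 (v + e τ), smul_neg]; abel
    calc torusSupNorm (fun _ : Fin (d + 1) => N) v
        = torusSupNorm (fun _ : Fin (d + 1) => N)
            (translate (fun _ : Fin (d + 1) => N) (wr (v + e τ) - e τ) (-centreVec (fun _ : Fin (d + 1) => N) (v + e τ))) := by rw [← e1]
      _ = torusSupNorm (fun _ : Fin (d + 1) => N) (wr (v + e τ) - e τ) := B4TorusKernel.MultiPeriod.torusSupNorm_translate _ _ _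
      _ ≤ supNorm (wr (v + e τ) - e τ) := B4TorusKernel.MultiPeriod.torusSupNorm_le_supNorm (fun _ => hN1) _
      _ ≤ supNorm (wr (v + e τ)) + 1 := by
          have := supNorm_le_add_e (wr (v + e τ) - e τ) τ
          rw [sub_add_cancel] at this
          exact this
  -- the extension
  refine ⟨fun y κ => f (c + wr (y - c)) κ, ?_, ?_, ?_, ?_⟩
  · -- periodic
    intro y i κ
    show f (c + wr (y + (N : ℤ) • e i - c)) κ = f (c + wr (y - c)) κ
    rw [show y + (N : ℤ) • e i - c = (y - c) + (N : ℤ) • e i by abel, W5]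
  · -- agreement near the centre
    intro y κ hy
    show f (c + wr (y - c)) κ = ψ y κ
    have hv : supNorm (wr (y - c)) ≤ (ℓt : ℝ) - 1 := by rw [W3]; exact hy
    have h1 := hfψ (c + wr (y - c)) κ (by rw [add_sub_cancel_left]; exact hv)
    rw [h1]
    have e1 : c + wr (y - c) = y + (N : ℤ) • centreVec (fun _ : Fin (d + 1) => N) (y - c) := by
      rw [W4]; abel
    rw [e1]
    exact dir_invariant_smul_of_isPeriodicDir hψP _ y κ
  · -- curl bound
    intro y μ ν
    have hB : 0 ≤ (1 + 12 * ((d : ℝ) + 1)) * ĝ₀ := by positivity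
    by_cases hfar : supNorm (wr (y - c)) ≤ ((2 * ℓt + 1 : ℕ) : ℝ)
    · -- deep inside: the shifted points have the shifted representatives
      have hμ : wr (y + e μ - c) = wr (y - c) + e μ := by
        rw [show y + e μ - c = (y - c) + e μ by abel]; exact hwr_small _ hfar μ
      have hν : wr (y + e ν - c) = wr (y - c) + e ν := by
        rw [show y + e ν - c = (y - c) + e ν by abel]; exact hwr_small _ hfar ν
      have hcf := hcurlf (c + wr (y - c)) μ ν
      rw [curlAt_flat_eq] at hcf ⊢
      show ‖(f (c + wr (y + e μ - c)) ν - f (c + wr (y - c)) ν) - (f (c + wr (y + e ν - c)) μ - f (c + wr (y - c)) μ)‖ ≤ _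
      rw [hμ, hν, ← add_assoc, ← add_assoc]
      exact hcf
    · -- far: every term vanishes
      push Not at hfar
      have hfar' : (2 * ℓt : ℝ) + 2 ≤ supNorm (wr (y - c)) := by
        have := supNorm_int_gap (wr (y - c)) (k := 2 * ℓt + 1) (by push_cast at hfar ⊢; exact hfar)
        push_cast at this; linarith
      have h0 : ∀ κ, f (c + wr (y - c)) κ = 0 := fun κ => hf0 _ κ (by rw [add_sub_cancel_left]; linarith)
      have hfarτ : ∀ τ, (2 * ℓt : ℝ) + 1 ≤ supNorm (wr (y + e τ - c)) := by
        intro τ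
        have := hwr_per (y - c) τ
        rw [← W3, show y - c + e τ = y + e τ - c by abel] at this
        linarith
      have hμ0 : ∀ κ, f (c + wr (y + e μ - c)) κ = 0 := fun κ => hf0 _ κ (by rw [add_sub_cancel_left]; exact hfarτ μ)
      have hν0 : ∀ κ, f (c + wr (y + e ν - c)) κ = 0 := fun κ => hf0 _ κ (by rw [add_sub_cancel_left]; exact hfarτ ν)
      rw [curlAt_flat_eq]
      show ‖(f (c + wr (y + e μ - c)) ν - f (c + wr (y - c)) ν) - (f (c + wr (y + e ν - c)) μ - f (c + wr (y - c)) μ)‖ ≤ _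
      rw [hμ0, hν0, h0, h0]
      simp only [sub_self, norm_zero]
      exact hB
  · -- size bound
    intro y κ
    exact hsizef _ κ

end

end Summit.QuantumFields.BalabanUV.T4Continuum.NE7CoarseSplitExtension
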